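import Summits.CriticalPhenomena.PercolationContinuityZ3.Theorems.PercNearOneGluingNoHeavyLowerTailSunflowerMergeLemma
import Summits.CriticalPhenomena.PercolationContinuityZ3.Theorems.PercNearOneGluingNoHeavyLowerTailSunflowerLSMCalculus

/-!
# `NoHeavyLowerTail` (crux stmt-CriticalPhenomena-4575), abstract sunflower cubic: the MERGING RULE for graded safety

Support file (seat `prim-ineq-prove-1` gen 35; `--supports stmt-CriticalPhenomena-4575`).  No `sorry`, no named facts.
Memo: run/shared/lean/prim/prim-ineq-prove-1/FINDING-PRINCIPALCORE-prove1-g34.md §9 (merging remark, rule (v″)) and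
FINDING-LSM-prove1-g35.md §5.

Gen 34 landed the analytic merging step `KDecreasing.prod_Ex_le_max_merge_of_supermod` on the cube `Finset g`.  This file does the
bookkeeping that turns it into a rule of the safe-core calculus:
* `BEx_eq_Ex` — block expectations `BEx p a` are `KDecreasing.Ex` on the subtype cube `Finset ↥a`;
* `prod_BEx_le_max_merge` — for `e ≠ e' ∈ a` with `0 < p e < 1`, `0 < p e'` and block functions `G i ∈ [c, 1]`, antitone and
  SUPERMODULAR IN THE PAIR `(e, e')`, the product `∏ BEx p a (G i)` is bounded by its value at one of the two MERGED parameter vectors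
  `mergeL p e e' = p[e ↦ p e·p e', e' ↦ 1]`, `mergeR p e e' = p[e ↦ 1, e' ↦ p e·p e']`;
* `minType` — the min-type majorant of a feasible family over a covering family `𝒯` of bad sets; it is feasible, and supermodular in
  every pair `(e, e')` such that no member of `𝒯` contains both ("siblings");
* **`gsafe_of_merge`** — if `A` (determined by the block, an up-set, with such a `𝒯`) is gradedly safe at both merged parameter vectors and
  these do not increase `μ(A)`, then `A` is gradedly safe at `p`.  (Next file: the class 𝓛 with PRINCIPAL leaves.)
-/

noncomputable section

namespace Summit.CriticalPhenomena.PercolationContinuityZ3.Theorems.SunflowerPartition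

namespace SafeCalc

open MeasureTheory Finset
open Literature.Probability.LatticeModels Literature.Probability.Percolation
open TwoGenCore (wmiss)

variable {ι : Type*} [DecidableEq ι] (p : ι → unitInterval)

/-! ## Block expectations as cube expectations -/

/-- `BEx p a G` is `KDecreasing.Ex` on the subtype cube `Finset ↥a`. [this work] -/
theorem BEx_eq_Ex (a : Finset ι) (G : Finset ι → ℝ) :
    BEx p a G = KDecreasing.Ex (g := ↥a) (fun x => (p x : ℝ)) (fun S => G (S.map (Function.Embedding.subtype (· ∈ a)))) := by
  classical
  let emb := Function.Embedding.subtype (· ∈ a)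
  have hmapsub : ∀ S : Finset ↥a, S.map emb ⊆ a := by
    intro S e he
    rw [Finset.mem_map] at he
    obtain ⟨x, _, rfl⟩ := he
    exact x.2
  unfold BEx KDecreasing.Ex
  symm
  refine Finset.sum_bij (fun S _ => S.map emb) (fun S _ => Finset.mem_powerset.2 (hmapsub S))
    (fun S _ S' _ h => Finset.map_injective _ h) (fun T hT => ?_) (fun S _ => ?_)
  · refine ⟨T.subtype (· ∈ a), Finset.mem_univ _, ?_⟩
    rw [Finset.mem_powerset] at hT
    exact Finset.subtype_map_of_mem fun x hx => hT hx
  · congr 1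
    unfold KDecreasing.wt TwoGenCore.wmiss
    set T := S.map emb with hT
    have h1 : (∏ x : ↥a, if x ∈ S then 1 - ((p x : unitInterval) : ℝ) else ((p x : unitInterval) : ℝ)) =
        ∏ e ∈ a, (if e ∈ T then 1 - (p e : ℝ) else (p e : ℝ)) := by
      rw [← Finset.prod_coe_sort a (fun e => if e ∈ T then 1 - (p e : ℝ) else (p e : ℝ))]
      refine Finset.prod_congr rfl fun x _ => ?_
      have hx : ((x : ι) ∈ T) ↔ x ∈ S := by rw [hT]; exact Finset.mem_map' _
      by_cases hxS : x ∈ S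
      · rw [if_pos hxS, if_pos (hx.2 hxS)]
      · rw [if_neg hxS, if_neg (fun h => hxS (hx.1 h))]
    rw [h1, Finset.prod_ite, Finset.filter_mem_eq_inter, Finset.inter_eq_right.2 (hmapsub S), Finset.filter_not,
      Finset.filter_mem_eq_inter, Finset.inter_eq_right.2 (hmapsub S)]

/-! ## The merged parameter vectors -/

/-- `p[e ↦ p e · p e', e' ↦ 1]`. [this work] -/
def mergeL (e e' : ι) : ι → unitInterval :=
  Function.update (Function.update p e ⟨(p e : ℝ) * (p e' : ℝ), unitInterval.mul_mem (p e).2 (p e').2⟩) e' 1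

/-- `p[e ↦ 1, e' ↦ p e · p e']`. [this work] -/
def mergeR (e e' : ι) : ι → unitInterval :=
  Function.update (Function.update p e 1) e' ⟨(p e : ℝ) * (p e' : ℝ), unitInterval.mul_mem (p e).2 (p e').2⟩

/-- The real values of `mergeL`. [this work] -/
theorem coe_mergeL (e e' : ι) (x : ι) :
    ((mergeL p e e' x : unitInterval) : ℝ) =
      Function.update (Function.update (fun y => ((p y : unitInterval) : ℝ)) e ((p e : ℝ) * (p e' : ℝ))) e' 1 x := by
  unfold mergeL
  by_cases hx : x = e'
  · subst hx; simp only [Function.update_self, Set.Icc.coe_one]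
  · rw [Function.update_of_ne hx, Function.update_of_ne hx]
    by_cases hx' : x = e
    · subst hx'; simp only [Function.update_self]
    · rw [Function.update_of_ne hx', Function.update_of_ne hx']

/-- The real values of `mergeR`. [this work] -/
theorem coe_mergeR (e e' : ι) (x : ι) :
    ((mergeR p e e' x : unitInterval) : ℝ) =
      Function.update (Function.update (fun y => ((p y : unitInterval) : ℝ)) e 1) e' ((p e : ℝ) * (p e' : ℝ)) x := by
  unfold mergeR
  by_cases hx : x = e'
  · subst hx; simp only [Function.update_self]
  · rw [Function.update_of_ne hx, Function.update_of_ne hx]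
    by_cases hx' : x = e
    · subst hx'; simp only [Function.update_self, Set.Icc.coe_one]
    · rw [Function.update_of_ne hx', Function.update_of_ne hx']

/-! ## The merging inequality for block functions -/

/-- **Merging two coordinates of the block.**  For block functions `G i ∈ [c,1]` (`c > 0`), antitone and supermodular in the pair
`(e, e')`, `∏ BEx p a (G i) ≤ max (∏ BEx (mergeL p e e') a (G i)) (∏ BEx (mergeR p e e') a (G i))`. [this work] -/
theorem prod_BEx_le_max_merge [Fintype ι] (a : Finset ι) {e e' : ι} (he : e ∈ a) (he' : e' ∈ a) (hne : e ≠ e')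
    (hpe0 : 0 < (p e : ℝ)) (hpe1 : (p e : ℝ) < 1) (hpe'0 : 0 < (p e' : ℝ)) {n : ℕ} (G : Fin n → Finset ι → ℝ) {c : ℝ}
    (hc : 0 < c) (hge : ∀ i, ∀ T : Finset ι, T ⊆ a → c ≤ G i T)
    (hanti : ∀ i, ∀ T T' : Finset ι, T ⊆ T' → T' ⊆ a → G i T' ≤ G i T)
    (hsm : ∀ i, ∀ T : Finset ι, T ⊆ a → G i (insert e T) + G i (insert e' T) ≤ G i T + G i (insert e (insert e' T))) :
    ∏ i, BEx p a (G i) ≤ max (∏ i, BEx (mergeL p e e') a (G i)) (∏ i, BEx (mergeR p e e') a (G i)) := by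
  classical
  have hmapsub : ∀ S : Finset ↥a, S.map (Function.Embedding.subtype (· ∈ a)) ⊆ a := by
    intro S x hx
    rw [Finset.mem_map] at hx
    obtain ⟨y, _, rfl⟩ := hx
    exact y.2
  let q : ↥a → ℝ := fun x => (p x : ℝ)
  have hq : ∀ x : ↥a, 0 ≤ q x ∧ q x ≤ 1 := fun x => ⟨(p x).2.1, (p x).2.2⟩
  let F : Fin n → Finset ↥a → ℝ := fun i S => G i (S.map (Function.Embedding.subtype (· ∈ a))) / c
  have hmap_insert : ∀ (x : ↥a) (S : Finset ↥a), (insert x S).map (Function.Embedding.subtype (· ∈ a)) =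
      insert (x : ι) (S.map (Function.Embedding.subtype (· ∈ a))) := fun x S => Finset.map_insert _ _ _
  have hF1 : ∀ i ∈ (univ : Finset (Fin n)), ∀ S, 1 ≤ F i S := fun i _ S =>
    (one_le_div hc).2 (hge i _ (hmapsub S))
  have hFanti : ∀ i ∈ (univ : Finset (Fin n)), ∀ (x : ↥a) (S : Finset ↥a), F i (insert x S) ≤ F i S := by
    intro i _ x S
    simp only [F, hmap_insert]
    exact div_le_div_of_nonneg_right (hanti i _ _ (Finset.subset_insert _ _)
      (Finset.insert_subset (x.2) (hmapsub S))) hc.le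
  have hne' : (⟨e, he⟩ : ↥a) ≠ ⟨e', he'⟩ := fun h => hne (congrArg Subtype.val h)
  have hFsm : ∀ i ∈ (univ : Finset (Fin n)), ∀ S : Finset ↥a,
      F i (insert ⟨e, he⟩ S) + F i (insert ⟨e', he'⟩ S) ≤ F i S + F i (insert ⟨e, he⟩ (insert ⟨e', he'⟩ S)) := by
    intro i _ S
    simp only [F, hmap_insert]
    rw [← add_div, ← add_div]
    exact div_le_div_of_nonneg_right (hsm i _ (hmapsub S)) hc.le
  have key := KDecreasing.prod_Ex_le_max_merge_of_supermod (g := ↥a) univ hq hne' hpe0 hpe1 hpe'0 F hFanti hFsm hF1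
  -- translate the three `Ex` back to `BEx`
  have hEx : ∀ (p' : ι → unitInterval) (i : Fin n),
      BEx p' a (G i) = c * KDecreasing.Ex (g := ↥a) (fun x => (p' x : ℝ)) (F i) := by
    intro p' i
    rw [BEx_eq_Ex]
    unfold KDecreasing.Ex
    rw [Finset.mul_sum]
    refine Finset.sum_congr rfl fun S _ => ?_
    simp only [F]
    rw [mul_comm c _, mul_assoc, div_mul_cancel₀ _ hc.ne']
  have hL : (fun x : ↥a => ((mergeL p e e' x : unitInterval) : ℝ)) =
      Function.update (Function.update q ⟨e, he⟩ (q ⟨e, he⟩ * q ⟨e', he'⟩)) ⟨e', he'⟩ 1 := by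
    funext x
    rw [coe_mergeL]
    by_cases hx : x = ⟨e', he'⟩
    · subst hx; simp only [Function.update_self]
    · have hx1 : (x : ι) ≠ e' := fun h => hx (Subtype.ext h)
      rw [Function.update_of_ne hx1, Function.update_of_ne hx]
      by_cases hx' : x = ⟨e, he⟩
      · subst hx'; simp only [Function.update_self, q]
      · have hx2 : (x : ι) ≠ e := fun h => hx' (Subtype.ext h)
        rw [Function.update_of_ne hx2, Function.update_of_ne hx']
  have hR : (fun x : ↥a => ((mergeR p e e' x : unitInterval) : ℝ)) =
      Function.update (Function.update q ⟨e, he⟩ 1) ⟨e', he'⟩ (q ⟨e, he⟩ * q ⟨e', he'⟩) := by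
    funext x
    rw [coe_mergeR]
    by_cases hx : x = ⟨e', he'⟩
    · subst hx; simp only [Function.update_self, q]
    · have hx1 : (x : ι) ≠ e' := fun h => hx (Subtype.ext h)
      rw [Function.update_of_ne hx1, Function.update_of_ne hx]
      by_cases hx' : x = ⟨e, he⟩
      · subst hx'; simp only [Function.update_self]
      · have hx2 : (x : ι) ≠ e := fun h => hx' (Subtype.ext h)
        rw [Function.update_of_ne hx2, Function.update_of_ne hx']
  have h0 : ∏ i, BEx p a (G i) = c ^ n * ∏ i, KDecreasing.Ex (g := ↥a) q (F i) := by
    rw [Finset.prod_congr rfl fun i _ => hEx p i, Finset.prod_mul_distrib, Finset.prod_const, card_univ, Fintype.card_fin]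
  have h1 : ∏ i, BEx (mergeL p e e') a (G i) =
      c ^ n * ∏ i, KDecreasing.Ex (g := ↥a) (Function.update (Function.update q ⟨e, he⟩ (q ⟨e, he⟩ * q ⟨e', he'⟩)) ⟨e', he'⟩ 1) (F i) := by
    rw [Finset.prod_congr rfl fun i _ => hEx (mergeL p e e') i, Finset.prod_mul_distrib, Finset.prod_const, card_univ,
      Fintype.card_fin, hL]
  have h2 : ∏ i, BEx (mergeR p e e') a (G i) =
      c ^ n * ∏ i, KDecreasing.Ex (g := ↥a) (Function.update (Function.update q ⟨e, he⟩ 1) ⟨e', he'⟩ (q ⟨e, he⟩ * q ⟨e', he'⟩)) (F i) := by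
    rw [Finset.prod_congr rfl fun i _ => hEx (mergeR p e e') i, Finset.prod_mul_distrib, Finset.prod_const, card_univ,
      Fintype.card_fin, hR]
  rw [h0, h1, h2, ← mul_max_of_nonneg _ _ (pow_nonneg hc.le n)]
  exact mul_le_mul_of_nonneg_left key (pow_nonneg hc.le n)

/-! ## The min-type majorant -/

/-- The min-type majorant of `G` over the members of `𝒯` inside `T` (`1` if there is none). [this work] -/
def minType (𝒯 : Finset (Finset ι)) (G : Finset ι → ℝ) (T : Finset ι) : ℝ :=
  if h : (𝒯.filter (· ⊆ T)).Nonempty then min 1 ((𝒯.filter (· ⊆ T)).inf' h G) else 1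

/-- The min-type majorant is at most one. [this work] -/
theorem minType_le_one (𝒯 : Finset (Finset ι)) (G : Finset ι → ℝ) (T : Finset ι) : minType 𝒯 G T ≤ 1 := by
  unfold minType; split_ifs
  · exact min_le_left _ _
  · exact le_rfl

/-- The min-type majorant is below every member value. [this work] -/
theorem minType_le_of_mem (𝒯 : Finset (Finset ι)) (G : Finset ι → ℝ) {T C : Finset ι} (hC : C ∈ 𝒯) (hCT : C ⊆ T) :
    minType 𝒯 G T ≤ G C := by
  have hmem : C ∈ 𝒯.filter (· ⊆ T) := Finset.mem_filter.2 ⟨hC, hCT⟩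
  unfold minType
  rw [dif_pos ⟨C, hmem⟩]
  exact (min_le_right _ _).trans (Finset.inf'_le _ hmem)

/-- Lower bounds of the min-type majorant. [this work] -/
theorem le_minType (𝒯 : Finset (Finset ι)) (G : Finset ι → ℝ) (T : Finset ι) {x : ℝ} (hx1 : x ≤ 1)
    (hx : ∀ C ∈ 𝒯, C ⊆ T → x ≤ G C) : x ≤ minType 𝒯 G T := by
  unfold minType
  split_ifs with h
  · refine le_min hx1 (Finset.le_inf' h _ fun C hC => ?_)
    rw [Finset.mem_filter] at hC
    exact hx C hC.1 hC.2
  · exact hx1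

/-- With no member inside, the min-type majorant is one. [this work] -/
theorem minType_eq_one (𝒯 : Finset (Finset ι)) (G : Finset ι → ℝ) {T : Finset ι} (h : ∀ C ∈ 𝒯, ¬ C ⊆ T) : minType 𝒯 G T = 1 := by
  unfold minType
  rw [dif_neg]
  rintro ⟨C, hC⟩
  rw [Finset.mem_filter] at hC
  exact h C hC.1 hC.2

/-- The min-type majorant is antitone. [this work] -/
theorem minType_anti (𝒯 : Finset (Finset ι)) (G : Finset ι → ℝ) {T T' : Finset ι} (h : T ⊆ T') :
    minType 𝒯 G T' ≤ minType 𝒯 G T :=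
  le_minType 𝒯 G T (minType_le_one _ _ _) fun _ hC hCT => minType_le_of_mem 𝒯 G hC (hCT.trans h)

/-- The min-type majorant is SUPERMODULAR IN A SIBLING PAIR: if no member of `𝒯` contains both `e` and `e'`. [this work] -/
theorem minType_supermod_pair (𝒯 : Finset (Finset ι)) (G : Finset ι → ℝ) {e e' : ι} (hsib : ∀ C ∈ 𝒯, ¬ (e ∈ C ∧ e' ∈ C))
    (T : Finset ι) :
    minType 𝒯 G (insert e T) + minType 𝒯 G (insert e' T) ≤ minType 𝒯 G T + minType 𝒯 G (insert e (insert e' T)) := by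
  -- every member inside `T ∪ {e,e'}` lies inside `T ∪ {e}` or inside `T ∪ {e'}`
  have hsplit : ∀ C ∈ 𝒯, C ⊆ insert e (insert e' T) → C ⊆ insert e T ∨ C ⊆ insert e' T := by
    intro C hC hCT
    by_cases hCe : e ∈ C
    · left
      intro x hx
      rcases Finset.mem_insert.1 (hCT hx) with rfl | hx'
      · exact Finset.mem_insert_self _ _
      · rcases Finset.mem_insert.1 hx' with rfl | hx''
        · exact absurd ⟨hCe, hx⟩ (hsib C hC)
        · exact Finset.mem_insert_of_mem hx''
    · right
      intro x hx
      rcases Finset.mem_insert.1 (hCT hx) with rfl | hx'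
      · exact absurd hx hCe
      · exact hx'
  -- the max of the two middle values is ≤ minType T, their min is = minType (T ∪ e ∪ e')
  have hA := minType_anti 𝒯 G (Finset.subset_insert e T)
  have hB := minType_anti 𝒯 G (Finset.subset_insert e' T)
  have hmin : min (minType 𝒯 G (insert e T)) (minType 𝒯 G (insert e' T)) ≤ minType 𝒯 G (insert e (insert e' T)) := by
    refine le_minType 𝒯 G _ ((min_le_left _ _).trans (minType_le_one _ _ _)) fun C hC hCT => ?_
    rcases hsplit C hC hCT with h | h
    · exact (min_le_left _ _).trans (minType_le_of_mem 𝒯 G hC h)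
    · exact (min_le_right _ _).trans (minType_le_of_mem 𝒯 G hC h)
  rcases le_total (minType 𝒯 G (insert e T)) (minType 𝒯 G (insert e' T)) with h | h
  · rw [min_eq_left h] at hmin; linarith
  · rw [min_eq_right h] at hmin; linarith

/-! ## The merging rule -/

/-- **Merging rule for graded safety.**  `A` determined by the block, an up-set, `𝒯` a covering family of bad sets no member of which
contains both `e` and `e'` (`e ≠ e' ∈ a`, `0 < p e < 1`, `0 < p e'`).  If `A` is gradedly safe at the two merged parameter vectors and
their `μ(A)` does not exceed `μ_p(A)`, then `A` is gradedly safe at `p`. [this work] -/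
theorem gsafe_of_merge [Fintype ι] (a : Finset ι) {A : Set (Set ι)} (hu : IsUpperSet A) {e e' : ι} (he : e ∈ a) (he' : e' ∈ a)
    (hne : e ≠ e') (hpe0 : 0 < (p e : ℝ)) (hpe1 : (p e : ℝ) < 1) (hpe'0 : 0 < (p e' : ℝ))
    (𝒯 : Finset (Finset ι)) (hbad : ∀ C ∈ 𝒯, ((a \ C : Finset ι) : Set ι) ∉ A)
    (hcov : ∀ T, T ⊆ a → ((a \ T : Finset ι) : Set ι) ∉ A → ∃ C ∈ 𝒯, C ⊆ T)
    (hsib : ∀ C ∈ 𝒯, ¬ (e ∈ C ∧ e' ∈ C))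
    (hL : GSafe (mergeL p e e') a A) (hR : GSafe (mergeR p e e') a A)
    (hμL : (prodBernoulli (mergeL p e e')).real A ≤ (prodBernoulli p).real A)
    (hμR : (prodBernoulli (mergeR p e e')).real A ≤ (prodBernoulli p).real A) : GSafe p a A := by
  classical
  intro n c hc hc1 G hanti hle1 hge hgood hbadG
  set μA := (prodBernoulli p).real A with hμA
  have hμ1 : μA ≤ 1 := measureReal_le_one
  -- bad is up-closed inside the block
  have hbad' : ∀ C ∈ 𝒯, ∀ T, T ⊆ a → C ⊆ T → ((a \ T : Finset ι) : Set ι) ∉ A := by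
    intro C hC T _ hCT hTA
    refine hbad C hC (hu ?_ hTA)
    intro x hx
    rw [Finset.mem_coe, Finset.mem_sdiff] at hx ⊢
    exact ⟨hx.1, fun h => hx.2 (hCT h)⟩
  -- the min-type majorant
  let G' : Fin n → Finset ι → ℝ := fun i => minType 𝒯 (G i)
  have hGG' : ∀ i T, T ⊆ a → G i T ≤ G' i T := fun i T hT =>
    le_minType 𝒯 (G i) T (hle1 i T hT) fun C _ hCT => hanti i C T hCT hT
  have hanti' : ∀ i, ∀ T T' : Finset ι, T ⊆ T' → T' ⊆ a → G' i T' ≤ G' i T := fun i T T' h _ => minType_anti 𝒯 (G i) h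
  have hle1' : ∀ i, ∀ T : Finset ι, T ⊆ a → G' i T ≤ 1 := fun i T _ => minType_le_one _ _ _
  have hge' : ∀ i, ∀ T : Finset ι, T ⊆ a → c ≤ G' i T := fun i T hT => (hge i T hT).trans (hGG' i T hT)
  have hgood' : ∀ i, ∀ T : Finset ι, T ⊆ a → ((a \ T : Finset ι) : Set ι) ∈ A → G' i T = 1 := by
    intro i T hT hTA
    exact minType_eq_one 𝒯 (G i) fun C hC hCT => hbad' C hC T hT hCT hTA
  have hbadG' : ∀ T : Finset ι, T ⊆ a → ((a \ T : Finset ι) : Set ι) ∉ A → ∏ i, G' i T ≤ c ^ (n - 1) := by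
    intro T hT hTA
    obtain ⟨C, hC, hCT⟩ := hcov T hT hTA
    have hCa : C ⊆ a := hCT.trans hT
    calc ∏ i, G' i T ≤ ∏ i, G i C :=
          Finset.prod_le_prod (fun i _ => hc.le.trans (hge' i T hT)) fun i _ => minType_le_of_mem 𝒯 (G i) hC hCT
      _ ≤ c ^ (n - 1) := hbadG C hCa (hbad C hC)
  have hsm' : ∀ i, ∀ T : Finset ι, T ⊆ a → G' i (insert e T) + G' i (insert e' T) ≤ G' i T + G' i (insert e (insert e' T)) :=
    fun i T _ => minType_supermod_pair 𝒯 (G i) hsib T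
  -- compare
  have step1 : ∏ i, BEx p a (G i) ≤ ∏ i, BEx p a (G' i) := by
    refine Finset.prod_le_prod (fun i _ => ?_) fun i _ => BEx_mono p a fun T hT => hGG' i T hT
    unfold BEx
    exact Finset.sum_nonneg fun T hT => mul_nonneg (wmiss_nonneg p a T) (hc.le.trans (hge i T (Finset.mem_powerset.1 hT)))
  have step2 := prod_BEx_le_max_merge p a he he' hne hpe0 hpe1 hpe'0 G' hc hge' hanti' hsm'
  have bL := hL n c hc hc1 G' hanti' hle1' hge' hgood' hbadG'
  have bR := hR n c hc hc1 G' hanti' hle1' hge' hgood' hbadG'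
  refine step1.trans (step2.trans (max_le (bL.trans ?_) (bR.trans ?_)))
  · have h0 : 0 ≤ (prodBernoulli (mergeL p e e')).real A := measureReal_nonneg
    exact pow_le_pow_left₀ (by nlinarith) (by nlinarith) _
  · have h0 : 0 ≤ (prodBernoulli (mergeR p e e')).real A := measureReal_nonneg
    exact pow_le_pow_left₀ (by nlinarith) (by nlinarith) _

end SafeCalc

end Summit.CriticalPhenomena.PercolationContinuityZ3.Theorems.SunflowerPartition
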